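import Summits.AnomalousDissipation.AnomalousDissipation.Theorems.SolenoidalFractalHomogenisationLagrangianStepCellLawVOddGainDefectAutocorr
import HarnessLib

/-!
# K1L `LagrangianRenormalisationStep(Design)` (K1L_D, stmt-AnomalousDissipation-27980; aside 24912), stub `stub_cellLawV0_IS`
# — W5 odd half, branch B of D24-16 (exact sector non-expansion of `f_T(B)`): PART 3/4 — SECTOR ATOMS: the resolvent atom `C(C² + s)⁻¹` of a coercive `τ`-sectorial block is `τ`-sectorial and accretive

(planner ad-ideate-p5 g8, lens «profile»; text byte-for-byte from the crux workfile `Cruxes/LagrangianRenormalisationStep/OddGainDefectAutocorr.lean`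
v2 = crux write 8ce4ef592c1f, split for the 400-line cap; lander: `--kind proof --supports stmt-AnomalousDissipation-27980 --as helper`).
NOT a proof of the stub, of the crux, of Onsager's conjecture or of anomalous dissipation — rung-leaf F-D1.A0 analysis.  No named facts, no sorry.
* `resolventAtom`, (private) `dotProduct_self_nonneg'`, `sq_le_of_forall_scale` (discriminant), `sq_add_le_of_sq_le` (sum rule), `sector_atom_pre`, **`sector_resolventAtom`** (pure algebra).
Landed by prover ad-k3l-bookkeeping-p1 g5 from the planner's landing kit `HOME/ad-ideate-p5/k1l-odd-defect/split/` (bodies = crux text byte-for-byte;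
gate-demanded one-line docstring added, deprecated `push_neg` → `push Not`, `dotProduct_self_nonneg'` made `private` (gate `dedup.landed`)).
-/

set_option linter.dupNamespace false

namespace Summit.AnomalousDissipation.AnomalousDissipation.Theorems.SolenoidalFractalHomogenisation.LagrangianStep.OddGain

open MeasureTheory Set Matrix Literature.Analysis Literature.Analysis.FluidPDE Literature.Analysis.FluidPDE.LatticeShear
open Literature.Analysis.ODE.PeriodicAveraging

/-- The resolvent atom `R_s(C) = C·(C² + s)⁻¹` (`= ∫₀^∞ cos(√s·u)e^{−uC} du` for coercive `C`, §11). -/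
noncomputable def resolventAtom (C : Matrix (Fin 3) (Fin 3) ℝ) (s : ℝ) : Matrix (Fin 3) (Fin 3) ℝ :=
  C * (C * C + s • (1 : Matrix (Fin 3) (Fin 3) ℝ))⁻¹

/-! ## §15 Sector atoms and EXACT SECTOR NON-EXPANSION of the slot response (branch B of D24-16: `θ = 1`, unconditional) -/

section SectorAtoms

/-- `0 ≤ x·x` (private: the public statement is `Literature.AlgebraicTopology.FundamentalGroup.GS3.dotProduct_self_nonneg'`, not imported here). [folklore] -/
private theorem dotProduct_self_nonneg' (x : Fin 3 → ℝ) : 0 ≤ x ⬝ᵥ x := by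
  rw [self_dotProduct_eq_sum_sq]; exact Finset.sum_nonneg fun i _ => sq_nonneg _

/-- Discriminant form of a sector inequality: `c·a ≤ m(c²X + Z)/2` for every real `c` (`X, Z ≥ 0`) forces `a² ≤ m²XZ`. -/
theorem sq_le_of_forall_scale {a m X Z : ℝ} (hX : 0 ≤ X) (hZ : 0 ≤ Z)
    (key : ∀ c : ℝ, c * a ≤ m * ((c ^ 2 * X + Z) / 2)) : a ^ 2 ≤ m ^ 2 * (X * Z) := by
  have hsum : 0 ≤ m * ((X + Z) / 2) := by
    have h1 := key 1
    have h2 := key (-1)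
    norm_num at h1 h2
    linarith
  by_cases hxx : X = 0
  · have h1 : ∀ c : ℝ, c * a ≤ m * Z / 2 := by
      intro c; have h := key c; rw [hxx, mul_zero, zero_add] at h; linarith
    have ha0 : a = 0 := by
      by_contra hne
      have hpos : 0 < a ^ 2 := by positivity
      have h3 := h1 ((m * Z / 2 + 1) / a)
      rw [div_mul_cancel₀ _ hne] at h3
      linarith
    rw [ha0, hxx]; simp
  · have hxpos : 0 < X := lt_of_le_of_ne hX (Ne.symm hxx)
    by_cases hm' : m = 0
    · have h1 : ∀ c : ℝ, c * a ≤ 0 := by intro c; have := key c; rw [hm'] at this; simpa using this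
      have ha0 : a = 0 := by
        have h2 := h1 a; have h3 := h1 (-a); nlinarith
      rw [ha0, hm']; simp
    · have hmnn : 0 ≤ m := by
        by_contra hmn
        push Not at hmn
        have : m * ((X + Z) / 2) < 0 := mul_neg_of_neg_of_pos hmn (by linarith)
        linarith
      have hmpos : 0 < m := lt_of_le_of_ne hmnn (Ne.symm hm')
      have h := key (a / (m * X))
      have hmx : 0 < m * X := mul_pos hmpos hxpos
      have e : a / (m * X) * a = a ^ 2 / (m * X) := by rw [div_mul_eq_mul_div, sq]
      rw [e] at h
      have e2 : (a / (m * X)) ^ 2 * X = a ^ 2 / (m ^ 2 * X) := by field_simp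
      rw [e2] at h
      have h3 : a ^ 2 / (m * X) ≤ m * Z := by
        have : m * ((a ^ 2 / (m ^ 2 * X) + Z) / 2) = a ^ 2 / (m * X) / 2 + m * Z / 2 := by field_simp
        rw [this] at h
        linarith
      rw [div_le_iff₀ hmx] at h3
      nlinarith

/-- The elementary sum rule behind the atom lemma: `α² ≤ τ²ab`, `β² ≤ τ²cd`, `a, b, c, d ≥ 0` give `(α + β)² ≤ τ²(a + c)(b + d)`. -/
theorem sq_add_le_of_sq_le {α β τ a b c d : ℝ} (ha : 0 ≤ a) (hb : 0 ≤ b) (hc : 0 ≤ c) (hd : 0 ≤ d)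
    (h₁ : α ^ 2 ≤ τ ^ 2 * (a * b)) (h₂ : β ^ 2 ≤ τ ^ 2 * (c * d)) :
    (α + β) ^ 2 ≤ τ ^ 2 * ((a + c) * (b + d)) := by
  -- 2αβ ≤ τ²(ad + bc):  (2αβ)² = 4α²β² ≤ 4τ⁴abcd ≤ τ⁴(ad + bc)²
  have hcross : 2 * (α * β) ≤ τ ^ 2 * (a * d + b * c) := by
    have hsq : (2 * (α * β)) ^ 2 ≤ (τ ^ 2 * (a * d + b * c)) ^ 2 := by
      have hab : α ^ 2 * β ^ 2 ≤ τ ^ 2 * (a * b) * (τ ^ 2 * (c * d)) :=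
        mul_le_mul h₁ h₂ (sq_nonneg _) (by positivity)
      have e1 : (2 * (α * β)) ^ 2 = 4 * (α ^ 2 * β ^ 2) := by ring
      have e2 : (τ ^ 2 * (a * d + b * c)) ^ 2 = (τ ^ 2 * (a * d - b * c)) ^ 2 + 4 * (τ ^ 2 * (a * b) * (τ ^ 2 * (c * d))) := by
        ring
      rw [e1, e2]
      nlinarith [sq_nonneg (τ ^ 2 * (a * d - b * c))]
    exact (abs_le_of_sq_le_sq' hsq (by positivity)).2
  nlinarith

/-- **THE ATOM LEMMA (pre-image form).**  If `C` is sectorial (`(xᵀCz − zᵀCx)² ≤ τ²(xᵀCx)(zᵀCz)`) and accretive, then for `s ≥ 0` the "resolvent atom"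
`R = C(C² + s)⁻¹` is sectorial with the SAME `τ`: writing `x = (C² + s)p`, `z = (C² + s)q` (so `Rx = Cp`, `Rz = Cq`), the sector inequality for `R` at
`(x, z)` is `(xᵀCq − zᵀCp)² ≤ τ²(xᵀCp)(zᵀCq)`, and with `u = Cp`, `v = Cq` one has `xᵀCq = vᵀCu + s·pᵀCq` etc., so it is the sum rule
`sq_add_le_of_sq_le` applied to the sector inequalities at `(u, v)` and at `(p, q)`.  (Complex form: `⟨Rw, w⟩ = conj⟨Bu, u⟩ + s⟨Bv, v⟩ ∈ S_θ`.) [folklore] -/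
theorem sector_atom_pre {C : Matrix (Fin 3) (Fin 3) ℝ} {τ s : ℝ} (hs : 0 ≤ s)
    (hsec : ∀ x z : Fin 3 → ℝ, (x ⬝ᵥ C *ᵥ z - z ⬝ᵥ C *ᵥ x) ^ 2 ≤ τ ^ 2 * ((x ⬝ᵥ C *ᵥ x) * (z ⬝ᵥ C *ᵥ z)))
    (hpos : ∀ x : Fin 3 → ℝ, 0 ≤ x ⬝ᵥ C *ᵥ x) (p q : Fin 3 → ℝ) :
    ((C *ᵥ (C *ᵥ p) + s • p) ⬝ᵥ (C *ᵥ q) - (C *ᵥ (C *ᵥ q) + s • q) ⬝ᵥ (C *ᵥ p)) ^ 2 ≤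
      τ ^ 2 * (((C *ᵥ (C *ᵥ p) + s • p) ⬝ᵥ (C *ᵥ p)) * ((C *ᵥ (C *ᵥ q) + s • q) ⬝ᵥ (C *ᵥ q))) ∧
    0 ≤ (C *ᵥ (C *ᵥ p) + s • p) ⬝ᵥ (C *ᵥ p) := by
  set u := C *ᵥ p with hu
  set v := C *ᵥ q with hv
  have e1 : (C *ᵥ u + s • p) ⬝ᵥ v = v ⬝ᵥ C *ᵥ u + s * (p ⬝ᵥ C *ᵥ q) := by
    rw [add_dotProduct, smul_dotProduct, smul_eq_mul, dotProduct_comm (C *ᵥ u) v, hv]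
  have e2 : (C *ᵥ v + s • q) ⬝ᵥ u = u ⬝ᵥ C *ᵥ v + s * (q ⬝ᵥ C *ᵥ p) := by
    rw [add_dotProduct, smul_dotProduct, smul_eq_mul, dotProduct_comm (C *ᵥ v) u, hu]
  have e3 : (C *ᵥ u + s • p) ⬝ᵥ u = u ⬝ᵥ C *ᵥ u + s * (p ⬝ᵥ C *ᵥ p) := by
    rw [add_dotProduct, smul_dotProduct, smul_eq_mul, dotProduct_comm (C *ᵥ u) u, hu]
  have e4 : (C *ᵥ v + s • q) ⬝ᵥ v = v ⬝ᵥ C *ᵥ v + s * (q ⬝ᵥ C *ᵥ q) := by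
    rw [add_dotProduct, smul_dotProduct, smul_eq_mul, dotProduct_comm (C *ᵥ v) v, hv]
  rw [e1, e2, e3, e4]
  refine ⟨?_, add_nonneg (hpos u) (mul_nonneg hs (hpos p))⟩
  have hα : (v ⬝ᵥ C *ᵥ u - u ⬝ᵥ C *ᵥ v) ^ 2 ≤ τ ^ 2 * ((u ⬝ᵥ C *ᵥ u) * (v ⬝ᵥ C *ᵥ v)) := by
    have h := hsec u v
    have e : (v ⬝ᵥ C *ᵥ u - u ⬝ᵥ C *ᵥ v) ^ 2 = (u ⬝ᵥ C *ᵥ v - v ⬝ᵥ C *ᵥ u) ^ 2 := by ring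
    rw [e]; exact h
  have hβ : (s * (p ⬝ᵥ C *ᵥ q) - s * (q ⬝ᵥ C *ᵥ p)) ^ 2 ≤ τ ^ 2 * ((s * (p ⬝ᵥ C *ᵥ p)) * (s * (q ⬝ᵥ C *ᵥ q))) := by
    have h := hsec p q
    have e : (s * (p ⬝ᵥ C *ᵥ q) - s * (q ⬝ᵥ C *ᵥ p)) ^ 2 = s ^ 2 * (p ⬝ᵥ C *ᵥ q - q ⬝ᵥ C *ᵥ p) ^ 2 := by ring
    rw [e]
    calc s ^ 2 * (p ⬝ᵥ C *ᵥ q - q ⬝ᵥ C *ᵥ p) ^ 2 ≤ s ^ 2 * (τ ^ 2 * ((p ⬝ᵥ C *ᵥ p) * (q ⬝ᵥ C *ᵥ q))) :=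
          mul_le_mul_of_nonneg_left h (sq_nonneg s)
      _ = τ ^ 2 * ((s * (p ⬝ᵥ C *ᵥ p)) * (s * (q ⬝ᵥ C *ᵥ q))) := by ring
  have h := sq_add_le_of_sq_le (hpos u) (hpos v) (mul_nonneg hs (hpos p)) (mul_nonneg hs (hpos q)) hα hβ
  have e : v ⬝ᵥ C *ᵥ u + s * (p ⬝ᵥ C *ᵥ q) - (u ⬝ᵥ C *ᵥ v + s * (q ⬝ᵥ C *ᵥ p)) =
      (v ⬝ᵥ C *ᵥ u - u ⬝ᵥ C *ᵥ v) + (s * (p ⬝ᵥ C *ᵥ q) - s * (q ⬝ᵥ C *ᵥ p)) := by ring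
  rw [e]; exact h

/-- **THE ATOM LEMMA.**  For a coercive sectorial `C` (`τ`, `lo > 0`) and `s ≥ 0`, the resolvent atom `R = C(C² + s)⁻¹` is `τ`-sectorial and accretive:
`(xᵀRz − zᵀRx)² ≤ τ²(xᵀRx)(zᵀRz)`, `xᵀRx ≥ 0`. [folklore] -/
theorem sector_resolventAtom {C : Matrix (Fin 3) (Fin 3) ℝ} {τ lo s : ℝ} (hlo : 0 < lo) (hs : 0 ≤ s)
    (hsec : ∀ x z : Fin 3 → ℝ, (x ⬝ᵥ C *ᵥ z - z ⬝ᵥ C *ᵥ x) ^ 2 ≤ τ ^ 2 * ((x ⬝ᵥ C *ᵥ x) * (z ⬝ᵥ C *ᵥ z)))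
    (hco : ∀ x : Fin 3 → ℝ, lo * (x ⬝ᵥ x) ≤ x ⬝ᵥ C *ᵥ x) (x z : Fin 3 → ℝ) :
    (x ⬝ᵥ (resolventAtom C s) *ᵥ z - z ⬝ᵥ (resolventAtom C s) *ᵥ x) ^ 2 ≤
      τ ^ 2 * ((x ⬝ᵥ (resolventAtom C s) *ᵥ x) * (z ⬝ᵥ (resolventAtom C s) *ᵥ z)) ∧
    0 ≤ x ⬝ᵥ (resolventAtom C s) *ᵥ x := by
  have hpos : ∀ x : Fin 3 → ℝ, 0 ≤ x ⬝ᵥ C *ᵥ x := fun x => le_trans (mul_nonneg hlo.le (dotProduct_self_nonneg' x)) (hco x)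
  set M := C * C + s • (1 : Matrix (Fin 3) (Fin 3) ℝ) with hM
  have hdet : IsUnit M.det := isUnit_det_sq_add_of_coercive hlo hs hco
  set p := M⁻¹ *ᵥ x with hp
  set q := M⁻¹ *ᵥ z with hq
  have hx : x = C *ᵥ (C *ᵥ p) + s • p := by
    have : M *ᵥ p = x := by rw [hp, Matrix.mulVec_mulVec, Matrix.mul_nonsing_inv _ hdet, Matrix.one_mulVec]
    rw [← this, hM, Matrix.add_mulVec, Matrix.smul_mulVec, Matrix.one_mulVec, ← Matrix.mulVec_mulVec]
  have hz : z = C *ᵥ (C *ᵥ q) + s • q := by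
    have : M *ᵥ q = z := by rw [hq, Matrix.mulVec_mulVec, Matrix.mul_nonsing_inv _ hdet, Matrix.one_mulVec]
    rw [← this, hM, Matrix.add_mulVec, Matrix.smul_mulVec, Matrix.one_mulVec, ← Matrix.mulVec_mulVec]
  have hRz : (resolventAtom C s) *ᵥ z = C *ᵥ q := by
    unfold resolventAtom; rw [← hM, ← Matrix.mulVec_mulVec]
  have hRx : (resolventAtom C s) *ᵥ x = C *ᵥ p := by
    unfold resolventAtom; rw [← hM, ← Matrix.mulVec_mulVec]
  rw [hRz, hRx]
  have h := sector_atom_pre (C := C) hs hsec hpos p q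
  have h' := sector_atom_pre (C := C) hs hsec hpos q p
  rw [← hx, ← hz] at h
  exact ⟨h.1, h.2⟩

end SectorAtoms

end Summit.AnomalousDissipation.AnomalousDissipation.Theorems.SolenoidalFractalHomogenisation.LagrangianStep.OddGain
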